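/-
Free seat `ym-line-cbag-p1` LEAD (prover-ym-line-cbag-p1-g5-0; own items 22254 `BoxFloorAllGroups` / 22893 `ExpChartPackage2` closed), route
`ColdBoxAllGroups`, helping crux `BulkAllGroups` (stmt-QuantumFields-22255), line `dlr-chessboard-G`, lead p2's PLAN v6 work package «p1:
KernelDatumBoundsG» — part 3: everything eventually in `β`; the deliverable `eventually_kernelDatum_boundsG`.
-/
import Summits.QuantumFields.YangMills.Theorems.ColdBoxAllGroupsBulkAllGroupsKernelDatumBoundsGWindow
import Literature.MathematicalPhysics.QuantumFieldTheory.Balaban1983to89.B9Eq376POneLetters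

/-!
# Crux `BulkAllGroups` (stmt-QuantumFields-22255), package «KernelDatumBoundsG», part 3: the PLAN-v6 windows and error terms, eventually

**`eventually_kernelDatum_boundsG`** (lead p2's PLAN v6, work package p1).  For `0 < θ ≤ 1/200` (`δ = θ/5`, `A = θ/20`, `ε = 6θ`) and all constants
`N, D, Ca > 0, CE, r₂ > 0, C₂ ≥ 0, η₀ > 0`, eventually in `β`: `1 ≤ β`, `8⌈β^{θ/20}⌉ ≤ ⌈β^θ⌉`, `L ≤ η₀`, `m ≤ 1/4`, `m ≤ r₂`, `mE ≤ m`, `r ≤ m`, the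
window `(D/2)(R+R')²/β + 190mE³ < β^{2(6θ)−1}`, `P ≤ 1/2`, and the two error sums of the cores with datum:
`COV-RHS = 6(2Nβ)²pY + 3M²(e^{2w}−1) + 6M²P + 2τ(M+K₁) + √P(2MK₁+K₂+K₁²) ≤ β^{−θ/2}`,
`MEAN-RHS = 2(2Nβ)pY + M(e^{2w}−1) + τ + 2(1+2D²(R'⁴+3))√P ≤ β^{−θ}`
(`pY = e^{−β^{6θ}}`, `M = β^{2(6θ)}`; notation of parts 1–2).  Each term is reduced to a monomial `Cβ^s` (binding exponent: `M²w ∼ β^{52θ−1/2}`,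
needs `52.5θ < 1/2`) or `Cβ^s e^{−bβ^{12θ}}` and handled by the generic reductions of part 1.  Pure real analysis; no sorry; no definition; standard
axioms.  NOT a claim about the mass gap: rung-level support (R2xi-G `XiPow`, RECORD label); the Yang–Mills mass gap is NOT proved by any of this.
-/

set_option autoImplicit false

noncomputable section

open Filter Topology Finset Real

namespace Summit.QuantumFields.YangMills.Theorems.ColdBoxAllGroups

open Summit.QuantumFields.YangMills.Theorems.WeakCouplingRates
open Literature.MathematicalPhysics.QuantumFieldTheory.Balaban1983to89.B9Eq376POneLetters (exp_two_mul_sub_one_le_four_mul)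

variable {θ Ca CE C₂ : ℝ}

/-! ## Windows, eventually -/

/-- `8⌈β^{θ/20}⌉ ≤ ⌈β^θ⌉` eventually (`θ > 0`). -/
theorem eventually_eight_ceil_le (hθ : 0 < θ) : ∀ᶠ β : ℝ in atTop, 8 * ⌈β ^ (θ / 20)⌉₊ ≤ ⌈β ^ θ⌉₊ := by
  obtain ⟨β₀, hβ₀1, h⟩ := exists_const_mul_rpow_le_rpow 16 (show θ / 20 < θ by linarith)
  filter_upwards [eventually_ge_atTop β₀] with β hβ
  have hβ1 : 1 ≤ β := hβ₀1.trans hβ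
  have hT2 : (⌈β ^ (θ / 20)⌉₊ : ℝ) ≤ 2 * β ^ (θ / 20) := natCeil_rpow_le_two_mul hβ1 (by positivity)
  have hHr : β ^ θ ≤ (⌈β ^ θ⌉₊ : ℝ) := Nat.le_ceil _
  have h16 := h β hβ
  have hr : (8 * ⌈β ^ (θ / 20)⌉₊ : ℝ) ≤ (⌈β ^ θ⌉₊ : ℝ) := by linarith
  exact_mod_cast hr

/-- A monomial with negative exponent is eventually below any `κ > 0`: `C·β^s ≤ κ` (`s < 0`). -/
theorem eventually_const_mul_rpow_le_of_neg {C s κ : ℝ} (hs : s < 0) (hκ : 0 < κ) : ∀ᶠ β : ℝ in atTop, C * β ^ s ≤ κ := by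
  have h := eventually_le_rpow_div_of_le_rpow (f := fun β => C * β ^ s) (b := 0) hs (one_div_pos.2 hκ) (fun β _ => le_rfl)
  filter_upwards [h] with β hβ
  rwa [Real.rpow_zero, one_div_one_div] at hβ

/-- **`L ≤ κ` eventually** (half the link radius; any `κ > 0`, `0 < θ ≤ 1/200`, `Ca ≥ 0`). -/
theorem eventually_halfLinkD_le (hθ : 0 < θ) (hθ2 : θ ≤ 1 / 200) (hCa : 0 ≤ Ca) {κ : ℝ} (hκ : 0 < κ) :
    ∀ᶠ β : ℝ in atTop, ((12 * (⌈β ^ θ⌉₊ : ℝ) ^ 2 + 2 * ⌈β ^ θ⌉₊ + 1) * (Real.sqrt 2 * Real.sqrt (β ^ (2 * (6 * θ) - 1)) + 8 * (Ca * β ^ (3 * θ + θ / 5 - 1 / 2)))) ≤ κ := by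
  filter_upwards [eventually_const_mul_rpow_le_of_neg (C := (106 * (Real.sqrt 2 + 8 * Ca)) / 2) (s := 8 * θ - 1 / 2) (by linarith) hκ,
    eventually_ge_atTop (1 : ℝ)] with β h hβ
  have hm := linkRadiusD_le hβ hθ.le hCa
  linarith

/-- **`m ≤ κ` eventually** (any `κ > 0`). -/
theorem eventually_linkD_le (hθ : 0 < θ) (hθ2 : θ ≤ 1 / 200) (hCa : 0 ≤ Ca) {κ : ℝ} (hκ : 0 < κ) :
    ∀ᶠ β : ℝ in atTop, (2 * ((12 * (⌈β ^ θ⌉₊ : ℝ) ^ 2 + 2 * ⌈β ^ θ⌉₊ + 1) * (Real.sqrt 2 * Real.sqrt (β ^ (2 * (6 * θ) - 1)) + 8 * (Ca * β ^ (3 * θ + θ / 5 - 1 / 2))))) ≤ κ := by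
  filter_upwards [eventually_const_mul_rpow_le_of_neg (C := (106 * (Real.sqrt 2 + 8 * Ca))) (s := 8 * θ - 1 / 2) (by linarith) hκ,
    eventually_ge_atTop (1 : ℝ)] with β h hβ
  exact (linkRadiusD_le hβ hθ.le hCa).trans h

/-- The three auxiliary smallness conditions of the window, eventually (`θ > 0`, `θ ≤ 1/200`). -/
theorem eventually_windowD_aux (D : ℕ) (hθ : 0 < θ) (hθ2 : θ ≤ 1 / 200) :
    ∀ᶠ β : ℝ in atTop,
      Real.sqrt D * ((49 * Real.sqrt CE + 4 * Ca) + 4 * Ca) * β ^ (3 * θ + θ / 5 - 1 / 2) ≤ β ^ (6 * θ - 1 / 2) / 4 ∧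
      (49 * Real.sqrt CE + 4 * Ca) * β ^ (3 * θ + θ / 5) ≤ β ^ (6 * θ) / (4 * (Real.sqrt D + 1)) ∧
      190 * (53 / 2) ^ 3 * β ^ (24 * θ - 3 / 2) ≤ β ^ (12 * θ - 1) / 2 := by
  have hD1 : (0 : ℝ) < 4 * (Real.sqrt D + 1) := by positivity
  filter_upwards [
    eventually_le_rpow_div_of_le_rpow (f := fun β => Real.sqrt D * ((49 * Real.sqrt CE + 4 * Ca) + 4 * Ca) * β ^ (3 * θ + θ / 5 - 1 / 2))
      (b := 6 * θ - 1 / 2) (by linarith) (by norm_num : (0 : ℝ) < 4) (fun β _ => le_rfl),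
    eventually_le_rpow_div_of_le_rpow (f := fun β => (49 * Real.sqrt CE + 4 * Ca) * β ^ (3 * θ + θ / 5))
      (b := 6 * θ) (by linarith) hD1 (fun β _ => le_rfl),
    eventually_le_rpow_div_of_le_rpow (f := fun β => 190 * (53 / 2) ^ 3 * β ^ (24 * θ - 3 / 2))
      (b := 12 * θ - 1) (by linarith) (by norm_num : (0 : ℝ) < 2) (fun β _ => le_rfl)] with β h1 h2 h3
  exact ⟨h1, h2, h3⟩

/-- **`P ≤ 1/2` eventually.** -/
theorem eventually_badMassD_le_half (D : ℕ) (hθ : 0 < θ) :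
    ∀ᶠ β : ℝ in atTop, (240 * (D : ℝ) * (2 * (⌈β ^ θ⌉₊ : ℝ) + 1) ^ 4 * Real.exp (-(β ^ (6 * θ) / (4 * (Real.sqrt D + 1))) ^ 2 / 2)) ≤ 1 / 2 := by
  have hb₀ : (0 : ℝ) < (1 / (32 * (Real.sqrt D + 1) ^ 2)) := by positivity
  have h := eventually_le_rpow_div_of_le_rpow_mul_exp (f := fun β => (240 * (D : ℝ) * (2 * (⌈β ^ θ⌉₊ : ℝ) + 1) ^ 4 * Real.exp (-(β ^ (6 * θ) / (4 * (Real.sqrt D + 1))) ^ 2 / 2))) (0 : ℝ) (by positivity : (0 : ℝ) < 12 * θ) hb₀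
    (by norm_num : (0 : ℝ) < 2) (fun β hβ => (badMassD_majorant D hβ hθ.le).1)
  filter_upwards [h] with β hβ
  rwa [Real.rpow_zero] at hβ

/-- **`w ≤ 1/2` eventually** (`0 < θ ≤ 1/200`). -/
theorem eventually_tiltD_le_half (hθ : 0 < θ) (hθ2 : θ ≤ 1 / 200) (hCa : 0 ≤ Ca) (hC₂ : 0 ≤ C₂) :
    ∀ᶠ β : ℝ in atTop, (120 * (2 * (⌈β ^ θ⌉₊ : ℝ) + 1) ^ 4 * (190 * β * (2 * ((12 * (⌈β ^ θ⌉₊ : ℝ) ^ 2 + 2 * ⌈β ^ θ⌉₊ + 1) * (Real.sqrt 2 * Real.sqrt (β ^ (2 * (6 * θ) - 1)) + 8 * (Ca * β ^ (3 * θ + θ / 5 - 1 / 2))))) ^ 3) + 4 * (2 * (⌈β ^ θ⌉₊ : ℝ) + 1) ^ 4 * (2 * C₂ * (2 * ((12 * (⌈β ^ θ⌉₊ : ℝ) ^ 2 + 2 * ⌈β ^ θ⌉₊ + 1) * (Real.sqrt 2 * Real.sqrt (β ^ (2 * (6 * θ) - 1)) + 8 * (Ca * β ^ (3 * θ + θ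 / 5 - 1 / 2))))) ^ 2)) ≤ 1 / 2 := by
  filter_upwards [eventually_const_mul_rpow_le_of_neg (C := (120 * 625 * 190 * (106 * (Real.sqrt 2 + 8 * Ca)) ^ 3)) (s := 28 * θ - 1 / 2) (by linarith) (by norm_num : (0 : ℝ) < 1 / 4),
    eventually_const_mul_rpow_le_of_neg (C := (4 * 625 * (2 * C₂) * (106 * (Real.sqrt 2 + 8 * Ca)) ^ 2)) (s := 20 * θ - 1) (by linarith) (by norm_num : (0 : ℝ) < 1 / 4),
    eventually_ge_atTop (1 : ℝ)] with β h1 h2 hβ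
  have hw := tiltD_majorant hβ hθ.le hCa hC₂
  linarith

/-! ## The error terms of the covariance core, eventually `≤ β^{−θ/2}/5` each -/

/-- **C1** (YM large fields): `6(2Nβ)²e^{−β^{6θ}} ≤ β^{−θ/2}/5` eventually. -/
theorem eventually_covD_T1 (N : ℕ) (hθ : 0 < θ) :
    ∀ᶠ β : ℝ in atTop, 6 * (2 * (N : ℝ) * β) * (2 * (N : ℝ) * β) * Real.exp (-(β ^ (6 * θ))) ≤ β ^ (-(θ / 2)) / 5 := by
  refine eventually_le_rpow_div_of_le_rpow_mul_exp (C := 24 * (N : ℝ) ^ 2) (s := 2) (a := 6 * θ) (b₀ := 1) (-(θ / 2))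
    (by positivity) one_pos (by norm_num) (fun β hβ => le_of_eq ?_)
  rw [one_mul, Real.rpow_two]; ring

/-- **C2** (tilt): `3M²(e^{2w}−1) ≤ β^{−θ/2}/5` eventually. -/
theorem eventually_covD_T2 (hθ : 0 < θ) (hθ2 : θ ≤ 1 / 200) (hCa : 0 ≤ Ca) (hC₂ : 0 ≤ C₂) :
    ∀ᶠ β : ℝ in atTop, 3 * (β ^ (2 * (6 * θ))) ^ 2 * (Real.exp (2 * (120 * (2 * (⌈β ^ θ⌉₊ : ℝ) + 1) ^ 4 * (190 * β * (2 * ((12 * (⌈β ^ θ⌉₊ : ℝ) ^ 2 + 2 * ⌈β ^ θ⌉₊ + 1) * (Real.sqrt 2 * Real.sqrt (β ^ (2 * (6 * θ) - 1)) + 8 * (Ca * β ^ (3 * θ + θ / 5 - 1 / 2))))) ^ 3) + 4 * (2 * (⌈β ^ θ⌉₊ : ℝ) + 1) ^ 4 * (2 * C₂ * (2 * ((12 * (⌈β ^ θ⌉₊ : ℝ) ^ 2 + 2 * ⌈β ^ θ⌉₊ + 1) * (Real.sqrt 2 * Real.sqrt (β ^ (2 * (6 * θ) - 1)) + 8 *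 (Ca * β ^ (3 * θ + θ / 5 - 1 / 2))))) ^ 2))) - 1) ≤ β ^ (-(θ / 2)) / 5 := by
  filter_upwards [eventually_tiltD_le_half hθ hθ2 hCa hC₂,
    eventually_le_rpow_div_of_le_rpow (f := fun β => 12 * (120 * 625 * 190 * (106 * (Real.sqrt 2 + 8 * Ca)) ^ 3) * β ^ (52 * θ - 1 / 2)) (b := -(θ / 2)) (s := 52 * θ - 1 / 2)
      (by linarith) (by norm_num : (0 : ℝ) < 10) (fun β _ => le_rfl),
    eventually_le_rpow_div_of_le_rpow (f := fun β => 12 * (4 * 625 * (2 * C₂) * (106 * (Real.sqrt 2 + 8 * Ca)) ^ 2) * β ^ (44 * θ - 1)) (b := -(θ / 2)) (s := 44 * θ - 1)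
      (by linarith) (by norm_num : (0 : ℝ) < 10) (fun β _ => le_rfl),
    eventually_ge_atTop (1 : ℝ)] with β hw h1 h2 hβ
  have hβ0 : 0 < β := by linarith
  have hr0 : 0 ≤ Ca * β ^ (3 * θ + θ / 5 - 1 / 2) := mul_nonneg hCa (Real.rpow_nonneg hβ0.le _)
  have hw0 : 0 ≤ (120 * (2 * (⌈β ^ θ⌉₊ : ℝ) + 1) ^ 4 * (190 * β * (2 * ((12 * (⌈β ^ θ⌉₊ : ℝ) ^ 2 + 2 * ⌈β ^ θ⌉₊ + 1) * (Real.sqrt 2 * Real.sqrt (β ^ (2 * (6 * θ) - 1)) + 8 * (Ca * β ^ (3 * θ + θ / 5 - 1 / 2))))) ^ 3) + 4 * (2 * (⌈β ^ θ⌉₊ : ℝ) + 1) ^ 4 * (2 * C₂ * (2 * ((12 * (⌈β ^ θ⌉₊ : ℝ) ^ 2 + 2 * ⌈β ^ θ⌉₊ + 1) * (Real.sqrt 2 * Real.sqrt (β ^ (2 * (6 * θ) - 1)) + 8 * (Ca * β ^ (3 * θ + θ / 5 - 1 / 2))))) ^ 2)) := by positivity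
  have hexp := exp_two_mul_sub_one_le_four_mul hw0 hw
  have hW := tiltD_majorant hβ hθ.le hCa hC₂
  rw [rpow_two_mul_six_sq hβ0.le]
  have e1 : β ^ (24 * θ) * β ^ (28 * θ - 1 / 2) = β ^ (52 * θ - 1 / 2) := by rw [← Real.rpow_add hβ0]; ring_nf
  have e2 : β ^ (24 * θ) * β ^ (20 * θ - 1) = β ^ (44 * θ - 1) := by rw [← Real.rpow_add hβ0]; ring_nf
  have hM0 : 0 ≤ 3 * β ^ (24 * θ) := by positivity
  calc 3 * β ^ (24 * θ) * (Real.exp (2 * (120 * (2 * (⌈β ^ θ⌉₊ : ℝ) + 1) ^ 4 * (190 * β * (2 * ((12 * (⌈β ^ θ⌉₊ : ℝ) ^ 2 + 2 * ⌈β ^ θ⌉₊ + 1) * (Real.sqrt 2 * Real.sqrt (β ^ (2 * (6 * θ) - 1)) + 8 * (Ca * β ^ (3 * θ + θ / 5 - 1 / 2))))) ^ 3) + 4 * (2 * (⌈β ^ θ⌉₊ : ℝ) + 1) ^ 4 * (2 * C₂ * (2 * ((12 * (⌈β ^ θ⌉₊ : ℝ) ^ 2 + 2 * ⌈β ^ θ⌉₊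 + 1) * (Real.sqrt 2 * Real.sqrt (β ^ (2 * (6 * θ) - 1)) + 8 * (Ca * β ^ (3 * θ + θ / 5 - 1 / 2))))) ^ 2))) - 1) ≤ 3 * β ^ (24 * θ) * (4 * (120 * (2 * (⌈β ^ θ⌉₊ : ℝ) + 1) ^ 4 * (190 * β * (2 * ((12 * (⌈β ^ θ⌉₊ : ℝ) ^ 2 + 2 * ⌈β ^ θ⌉₊ + 1) * (Real.sqrt 2 * Real.sqrt (β ^ (2 * (6 * θ) - 1)) + 8 * (Ca * β ^ (3 * θ + θ / 5 - 1 / 2))))) ^ 3) + 4 * (2 * (⌈β ^ θ⌉₊ : ℝ) + 1) ^ 4 * (2 * C₂ * (2 * ((12 * (⌈β ^ θ⌉₊ : ℝ) ^ 2 + 2 * ⌈β ^ θ⌉₊ + 1) * (Real.sqrt 2 * Real.sqrt (β ^ (2 * (6 * θ) - 1)) + 8 * (Ca * β ^ (3 * θ + θ / 5 - 1 / 2))))) ^ 2))) := mul_le_mul_of_nonneg_left hexp hM0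
    _ ≤ 3 * β ^ (24 * θ) * (4 * ((120 * 625 * 190 * (106 * (Real.sqrt 2 + 8 * Ca)) ^ 3) * β ^ (28 * θ - 1 / 2) + (4 * 625 * (2 * C₂) * (106 * (Real.sqrt 2 + 8 * Ca)) ^ 2) * β ^ (20 * θ - 1))) := by gcongr
    _ = 12 * (120 * 625 * 190 * (106 * (Real.sqrt 2 + 8 * Ca)) ^ 3) * (β ^ (24 * θ) * β ^ (28 * θ - 1 / 2)) + 12 * (4 * 625 * (2 * C₂) * (106 * (Real.sqrt 2 + 8 * Ca)) ^ 2) * (β ^ (24 * θ) * β ^ (20 * θ - 1)) := by ring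
    _ = 12 * (120 * 625 * 190 * (106 * (Real.sqrt 2 + 8 * Ca)) ^ 3) * β ^ (52 * θ - 1 / 2) + 12 * (4 * 625 * (2 * C₂) * (106 * (Real.sqrt 2 + 8 * Ca)) ^ 2) * β ^ (44 * θ - 1) := by rw [e1, e2]
    _ ≤ β ^ (-(θ / 2)) / 5 := by linarith

/-- **C3** (Gaussian bad mass): `6M²P ≤ β^{−θ/2}/5` eventually. -/
theorem eventually_covD_T3 (D : ℕ) (hθ : 0 < θ) :
    ∀ᶠ β : ℝ in atTop, 6 * (β ^ (2 * (6 * θ))) ^ 2 * (240 * (D : ℝ) * (2 * (⌈β ^ θ⌉₊ : ℝ) + 1) ^ 4 * Real.exp (-(β ^ (6 * θ) / (4 * (Real.sqrt D + 1))) ^ 2 / 2)) ≤ β ^ (-(θ / 2)) / 5 := by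
  have hb₀ : (0 : ℝ) < (1 / (32 * (Real.sqrt D + 1) ^ 2)) := by positivity
  refine eventually_le_rpow_div_of_le_rpow_mul_exp (C := 6 * (150000 * (D : ℝ))) (s := 28 * θ) (a := 12 * θ) (b₀ := (1 / (32 * (Real.sqrt D + 1) ^ 2)))
    (-(θ / 2)) (by positivity) hb₀ (by norm_num) (fun β hβ => ?_)
  have hβ0 : 0 < β := by linarith
  have hP := (badMassD_majorant D hβ hθ.le).1
  rw [rpow_two_mul_six_sq hβ0.le]
  have e : β ^ (24 * θ) * β ^ (4 * θ) = β ^ (28 * θ) := by rw [← Real.rpow_add hβ0]; ring_nf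
  have hM0 : 0 ≤ 6 * β ^ (24 * θ) := by positivity
  calc 6 * β ^ (24 * θ) * (240 * (D : ℝ) * (2 * (⌈β ^ θ⌉₊ : ℝ) + 1) ^ 4 * Real.exp (-(β ^ (6 * θ) / (4 * (Real.sqrt D + 1))) ^ 2 / 2)) ≤ 6 * β ^ (24 * θ) * (150000 * (D : ℝ) * β ^ (4 * θ) * Real.exp (-((1 / (32 * (Real.sqrt D + 1) ^ 2)) * β ^ (12 * θ)))) := mul_le_mul_of_nonneg_left hP hM0
    _ = 6 * (150000 * (D : ℝ)) * (β ^ (24 * θ) * β ^ (4 * θ)) * Real.exp (-((1 / (32 * (Real.sqrt D + 1) ^ 2)) * β ^ (12 * θ))) := by ring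
    _ = _ := by rw [e]

/-- **C4** (surrogate): `2τ(M + K₁) ≤ β^{−θ/2}/5` eventually. -/
theorem eventually_covD_T4 (D : ℕ) (hθ : 0 < θ) (hθ2 : θ ≤ 1 / 200) (hCa : 0 ≤ Ca) :
    ∀ᶠ β : ℝ in atTop, 2 * (190 * β * (2 * ((12 * (⌈β ^ θ⌉₊ : ℝ) ^ 2 + 2 * ⌈β ^ θ⌉₊ + 1) * (Real.sqrt 2 * Real.sqrt (β ^ (2 * (6 * θ) - 1)) + 8 * (Ca * β ^ (3 * θ + θ / 5 - 1 / 2))))) ^ 3) * (β ^ (2 * (6 * θ)) + (2 * (D : ℝ) * ((Real.sqrt (β * (CE * (2 * (⌈β ^ θ⌉₊ : ℝ) + 3) ^ 4 * β ^ (2 * (θ / 5) - 1))) + 4 * (Real.sqrt β * (Ca * β ^ (3 * θ + θ / 5 - 1 / 2)))) ^ 2 + 2))) ≤ β ^ (-(θ / 2)) / 5 := by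
  refine eventually_le_rpow_div_of_le_rpow (C := 380 * (106 * (Real.sqrt 2 + 8 * Ca)) ^ 3 * (1 + (2 * (D : ℝ) * ((49 * Real.sqrt CE + 4 * Ca) ^ 2 + 2)))) (s := 36 * θ - 1 / 2) (b := -(θ / 2))
    (by linarith) (by norm_num) (fun β hβ => ?_)
  have hβ0 : 0 < β := by linarith
  have hτ := cubicD_majorant hβ hθ.le hCa
  obtain ⟨hK1, -, -, -⟩ := momentsD_majorant (CE := CE) D hβ hθ.le hCa
  have hr0 : 0 ≤ Ca * β ^ (3 * θ + θ / 5 - 1 / 2) := mul_nonneg hCa (Real.rpow_nonneg hβ0.le _)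
  have hτ0 : 0 ≤ (190 * β * (2 * ((12 * (⌈β ^ θ⌉₊ : ℝ) ^ 2 + 2 * ⌈β ^ θ⌉₊ + 1) * (Real.sqrt 2 * Real.sqrt (β ^ (2 * (6 * θ) - 1)) + 8 * (Ca * β ^ (3 * θ + θ / 5 - 1 / 2))))) ^ 3) := by positivity
  have hk1 : 0 ≤ (2 * (D : ℝ) * ((49 * Real.sqrt CE + 4 * Ca) ^ 2 + 2)) := by positivity
  have hmono : β ^ (2 * (3 * θ + θ / 5)) ≤ β ^ (12 * θ) := Real.rpow_le_rpow_of_exponent_le hβ (by linarith)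
  have hMK : β ^ (2 * (6 * θ)) + (2 * (D : ℝ) * ((Real.sqrt (β * (CE * (2 * (⌈β ^ θ⌉₊ : ℝ) + 3) ^ 4 * β ^ (2 * (θ / 5) - 1))) + 4 * (Real.sqrt β * (Ca * β ^ (3 * θ + θ / 5 - 1 / 2)))) ^ 2 + 2)) ≤ (1 + (2 * (D : ℝ) * ((49 * Real.sqrt CE + 4 * Ca) ^ 2 + 2))) * β ^ (12 * θ) := by
    rw [rpow_two_mul_six]
    nlinarith
  have hMK0 : 0 ≤ β ^ (2 * (6 * θ)) + (2 * (D : ℝ) * ((Real.sqrt (β * (CE * (2 * (⌈β ^ θ⌉₊ : ℝ) + 3) ^ 4 * β ^ (2 * (θ / 5) - 1))) + 4 * (Real.sqrt β * (Ca * β ^ (3 * θ + θ / 5 - 1 / 2)))) ^ 2 + 2)) := by positivity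
  have e : β ^ (24 * θ - 1 / 2) * β ^ (12 * θ) = β ^ (36 * θ - 1 / 2) := by rw [← Real.rpow_add hβ0]; ring_nf
  have hpos : 0 ≤ (1 + (2 * (D : ℝ) * ((49 * Real.sqrt CE + 4 * Ca) ^ 2 + 2))) * β ^ (12 * θ) := by positivity
  calc 2 * (190 * β * (2 * ((12 * (⌈β ^ θ⌉₊ : ℝ) ^ 2 + 2 * ⌈β ^ θ⌉₊ + 1) * (Real.sqrt 2 * Real.sqrt (β ^ (2 * (6 * θ) - 1)) + 8 * (Ca * β ^ (3 * θ + θ / 5 - 1 / 2))))) ^ 3) * (β ^ (2 * (6 * θ)) + (2 * (D : ℝ) * ((Real.sqrt (β * (CE * (2 * (⌈β ^ θ⌉₊ : ℝ) + 3) ^ 4 * β ^ (2 * (θ / 5) - 1))) + 4 * (Real.sqrt β * (Ca * β ^ (3 * θ + θ / 5 - 1 / 2)))) ^ 2 + 2))) ≤ 2 * (190 * (106 * (Real.sqrt 2 + 8 * Ca)) ^ 3 * β ^ (24 * θ - 1 / 2)) * ((1 + (2 * (D : ℝ) * ((49 * Real.sqrt CE + 4 * Ca) ^ 2 + 2)))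 * β ^ (12 * θ)) := by
        gcongr
    _ = 380 * (106 * (Real.sqrt 2 + 8 * Ca)) ^ 3 * (1 + (2 * (D : ℝ) * ((49 * Real.sqrt CE + 4 * Ca) ^ 2 + 2))) * (β ^ (24 * θ - 1 / 2) * β ^ (12 * θ)) := by ring
    _ = _ := by rw [e]

/-- **C5** (Cauchy–Schwarz on the Gaussian bad event): `√P(2MK₁ + K₂ + K₁²) ≤ β^{−θ/2}/5` eventually. -/
theorem eventually_covD_T5 (D : ℕ) (hθ : 0 < θ) (hCa : 0 ≤ Ca) :
    ∀ᶠ β : ℝ in atTop, Real.sqrt (240 * (D : ℝ) * (2 * (⌈β ^ θ⌉₊ : ℝ) + 1) ^ 4 * Real.exp (-(β ^ (6 * θ) / (4 * (Real.sqrt D + 1))) ^ 2 / 2)) * (2 * β ^ (2 * (6 * θ)) * (2 * (D : ℝ) * ((Real.sqrt (β * (CE * (2 * (⌈β ^ θ⌉₊ : ℝ) + 3) ^ 4 * β ^ (2 * (θ / 5) - 1))) + 4 * (Real.sqrt β * (Ca * β ^ (3 * θ + θ / 5 - 1 / 2)))) ^ 2 + 2)) + (3 * (D : ℝ) ^ 2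 * ((Real.sqrt (β * (CE * (2 * (⌈β ^ θ⌉₊ : ℝ) + 3) ^ 4 * β ^ (2 * (θ / 5) - 1))) + 4 * (Real.sqrt β * (Ca * β ^ (3 * θ + θ / 5 - 1 / 2)))) ^ 4 + 11)) + (2 * (D : ℝ) * ((Real.sqrt (β * (CE * (2 * (⌈β ^ θ⌉₊ : ℝ) + 3) ^ 4 * β ^ (2 * (θ / 5) - 1))) + 4 * (Real.sqrt β * (Ca * β ^ (3 * θ + θ / 5 - 1 / 2)))) ^ 2 + 2)) ^ 2) ≤ β ^ (-(θ / 2)) / 5 := by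
  have hb₀ : (0 : ℝ) < (1 / (64 * (Real.sqrt D + 1) ^ 2)) := by positivity
  refine eventually_le_rpow_div_of_le_rpow_mul_exp (C := Real.sqrt (150000 * (D : ℝ)) * (2 * (2 * (D : ℝ) * ((49 * Real.sqrt CE + 4 * Ca) ^ 2 + 2)) + (3 * (D : ℝ) ^ 2 * ((49 * Real.sqrt CE + 4 * Ca) ^ 4 + 11)) + (4 * (D : ℝ) ^ 2 * ((49 * Real.sqrt CE + 4 * Ca) ^ 2 + 2) ^ 2)))
    (s := 2 * θ + (12 * θ + 2 * (3 * θ + θ / 5))) (a := 12 * θ) (b₀ := (1 / (64 * (Real.sqrt D + 1) ^ 2))) (-(θ / 2)) (by positivity) hb₀ (by norm_num)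
    (fun β hβ => ?_)
  have hβ0 : 0 < β := by linarith
  obtain ⟨-, hsP⟩ := badMassD_majorant D hβ hθ.le
  obtain ⟨hK1, hK2, hK3, -⟩ := momentsD_majorant (CE := CE) D hβ hθ.le hCa
  have hR'0 := backgroundD_nonneg hβ0.le hCa θ CE
  have hK10 : 0 ≤ (2 * (D : ℝ) * ((Real.sqrt (β * (CE * (2 * (⌈β ^ θ⌉₊ : ℝ) + 3) ^ 4 * β ^ (2 * (θ / 5) - 1))) + 4 * (Real.sqrt β * (Ca * β ^ (3 * θ + θ / 5 - 1 / 2)))) ^ 2 + 2)) := by positivity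
  have hk1 : 0 ≤ (2 * (D : ℝ) * ((49 * Real.sqrt CE + 4 * Ca) ^ 2 + 2)) := by positivity
  have hk2 : 0 ≤ (3 * (D : ℝ) ^ 2 * ((49 * Real.sqrt CE + 4 * Ca) ^ 4 + 11)) := by positivity
  have hk3 : 0 ≤ (4 * (D : ℝ) ^ 2 * ((49 * Real.sqrt CE + 4 * Ca) ^ 2 + 2) ^ 2) := by positivity
  have hmono : β ^ (4 * (3 * θ + θ / 5)) ≤ β ^ (12 * θ + 2 * (3 * θ + θ / 5)) := Real.rpow_le_rpow_of_exponent_le hβ (by linarith)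
  have e1 : β ^ (12 * θ) * β ^ (2 * (3 * θ + θ / 5)) = β ^ (12 * θ + 2 * (3 * θ + θ / 5)) := by rw [← Real.rpow_add hβ0]
  have hpoly : 2 * β ^ (2 * (6 * θ)) * (2 * (D : ℝ) * ((Real.sqrt (β * (CE * (2 * (⌈β ^ θ⌉₊ : ℝ) + 3) ^ 4 * β ^ (2 * (θ / 5) - 1))) + 4 * (Real.sqrt β * (Ca * β ^ (3 * θ + θ / 5 - 1 / 2)))) ^ 2 + 2)) + (3 * (D : ℝ) ^ 2 * ((Real.sqrt (β * (CE * (2 * (⌈β ^ θ⌉₊ : ℝ) + 3) ^ 4 * β ^ (2 * (θ / 5) - 1))) + 4 * (Real.sqrt β * (Ca * β ^ (3 * θ + θ / 5 - 1 / 2)))) ^ 4 + 11)) + (2 * (D : ℝ) * ((Real.sqrt (β * (CE * (2 * (⌈β ^ θ⌉₊ : ℝ) + 3) ^ 4 * β ^ (2 * (θ / 5) - 1))) + 4 * (Real.sqrt β * (Ca * β ^ (3 * θ + θ / 5 - 1 / 2)))) ^ 2 + 2)) ^ 2 ≤ (2 * (2 * (D : ℝ) * ((49 * Real.sqrt CE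 + 4 * Ca) ^ 2 + 2)) + (3 * (D : ℝ) ^ 2 * ((49 * Real.sqrt CE + 4 * Ca) ^ 4 + 11)) + (4 * (D : ℝ) ^ 2 * ((49 * Real.sqrt CE + 4 * Ca) ^ 2 + 2) ^ 2)) * β ^ (12 * θ + 2 * (3 * θ + θ / 5)) := by
    rw [rpow_two_mul_six]
    have hM0 : 0 ≤ 2 * β ^ (12 * θ) := by positivity
    have h1 : 2 * β ^ (12 * θ) * (2 * (D : ℝ) * ((Real.sqrt (β * (CE * (2 * (⌈β ^ θ⌉₊ : ℝ) + 3) ^ 4 * β ^ (2 * (θ / 5) - 1))) + 4 * (Real.sqrt β * (Ca * β ^ (3 * θ + θ / 5 - 1 / 2)))) ^ 2 + 2)) ≤ 2 * (2 * (D : ℝ) * ((49 * Real.sqrt CE + 4 * Ca) ^ 2 + 2)) * β ^ (12 * θ + 2 * (3 * θ + θ / 5)) := by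
      calc 2 * β ^ (12 * θ) * (2 * (D : ℝ) * ((Real.sqrt (β * (CE * (2 * (⌈β ^ θ⌉₊ : ℝ) + 3) ^ 4 * β ^ (2 * (θ / 5) - 1))) + 4 * (Real.sqrt β * (Ca * β ^ (3 * θ + θ / 5 - 1 / 2)))) ^ 2 + 2)) ≤ 2 * β ^ (12 * θ) * ((2 * (D : ℝ) * ((49 * Real.sqrt CE + 4 * Ca) ^ 2 + 2)) * β ^ (2 * (3 * θ + θ / 5))) := mul_le_mul_of_nonneg_left hK1 hM0
        _ = 2 * (2 * (D : ℝ) * ((49 * Real.sqrt CE + 4 * Ca) ^ 2 + 2)) * (β ^ (12 * θ) * β ^ (2 * (3 * θ + θ / 5))) := by ring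
        _ = _ := by rw [e1]
    nlinarith
  have hpoly0 : 0 ≤ 2 * β ^ (2 * (6 * θ)) * (2 * (D : ℝ) * ((Real.sqrt (β * (CE * (2 * (⌈β ^ θ⌉₊ : ℝ) + 3) ^ 4 * β ^ (2 * (θ / 5) - 1))) + 4 * (Real.sqrt β * (Ca * β ^ (3 * θ + θ / 5 - 1 / 2)))) ^ 2 + 2)) + (3 * (D : ℝ) ^ 2 * ((Real.sqrt (β * (CE * (2 * (⌈β ^ θ⌉₊ : ℝ) + 3) ^ 4 * β ^ (2 * (θ / 5) - 1))) + 4 * (Real.sqrt β * (Ca * β ^ (3 * θ + θ / 5 - 1 / 2)))) ^ 4 + 11)) + (2 * (D : ℝ) * ((Real.sqrt (β * (CE * (2 * (⌈β ^ θ⌉₊ : ℝ) + 3) ^ 4 * β ^ (2 * (θ / 5) - 1))) + 4 * (Real.sqrt β * (Ca * β ^ (3 * θ + θ / 5 - 1 / 2)))) ^ 2 + 2)) ^ 2 := by positivity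
  have hsP0 : 0 ≤ Real.sqrt (240 * (D : ℝ) * (2 * (⌈β ^ θ⌉₊ : ℝ) + 1) ^ 4 * Real.exp (-(β ^ (6 * θ) / (4 * (Real.sqrt D + 1))) ^ 2 / 2)) := Real.sqrt_nonneg _
  have e2 : β ^ (2 * θ) * β ^ (12 * θ + 2 * (3 * θ + θ / 5)) = β ^ (2 * θ + (12 * θ + 2 * (3 * θ + θ / 5))) := by
    rw [← Real.rpow_add hβ0]
  have hE0 : 0 ≤ Real.exp (-((1 / (64 * (Real.sqrt D + 1) ^ 2)) * β ^ (12 * θ))) := (Real.exp_pos _).le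
  calc Real.sqrt (240 * (D : ℝ) * (2 * (⌈β ^ θ⌉₊ : ℝ) + 1) ^ 4 * Real.exp (-(β ^ (6 * θ) / (4 * (Real.sqrt D + 1))) ^ 2 / 2)) * (2 * β ^ (2 * (6 * θ)) * (2 * (D : ℝ) * ((Real.sqrt (β * (CE * (2 * (⌈β ^ θ⌉₊ : ℝ) + 3) ^ 4 * β ^ (2 * (θ / 5) - 1))) + 4 * (Real.sqrt β * (Ca * β ^ (3 * θ + θ / 5 - 1 / 2)))) ^ 2 + 2)) + (3 * (D : ℝ) ^ 2 * ((Real.sqrt (β * (CE * (2 * (⌈β ^ θ⌉₊ : ℝ) + 3) ^ 4 * β ^ (2 * (θ / 5) - 1))) + 4 * (Real.sqrt β * (Ca * β ^ (3 * θ + θ / 5 - 1 / 2)))) ^ 4 + 11)) + (2 * (D : ℝ) * ((Real.sqrt (β * (CE * (2 * (⌈β ^ θ⌉₊ : ℝ) + 3) ^ 4 * β ^ (2 * (θ / 5) - 1))) + 4 * (Real.sqrt β * (Ca * β ^ (3 * θ + θ / 5 - 1 / 2)))) ^ 2 + 2)) ^ 2)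
      ≤ (Real.sqrt (150000 * (D : ℝ)) * β ^ (2 * θ) * Real.exp (-((1 / (64 * (Real.sqrt D + 1) ^ 2)) * β ^ (12 * θ)))) * ((2 * (2 * (D : ℝ) * ((49 * Real.sqrt CE + 4 * Ca) ^ 2 + 2)) + (3 * (D : ℝ) ^ 2 * ((49 * Real.sqrt CE + 4 * Ca) ^ 4 + 11)) + (4 * (D : ℝ) ^ 2 * ((49 * Real.sqrt CE + 4 * Ca) ^ 2 + 2) ^ 2)) * β ^ (12 * θ + 2 * (3 * θ + θ / 5))) :=
        mul_le_mul hsP hpoly hpoly0 (by positivity)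
    _ = Real.sqrt (150000 * (D : ℝ)) * (2 * (2 * (D : ℝ) * ((49 * Real.sqrt CE + 4 * Ca) ^ 2 + 2)) + (3 * (D : ℝ) ^ 2 * ((49 * Real.sqrt CE + 4 * Ca) ^ 4 + 11)) + (4 * (D : ℝ) ^ 2 * ((49 * Real.sqrt CE + 4 * Ca) ^ 2 + 2) ^ 2)) * (β ^ (2 * θ) * β ^ (12 * θ + 2 * (3 * θ + θ / 5))) * Real.exp (-((1 / (64 * (Real.sqrt D + 1) ^ 2)) * β ^ (12 * θ))) := by ring
    _ = _ := by rw [e2]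

/-! ## The error terms of the mean core, eventually `≤ β^{−θ}/4` each -/

/-- **M1**: `2(2Nβ)e^{−β^{6θ}} ≤ β^{−θ}/4` eventually. -/
theorem eventually_meanD_T1 (N : ℕ) (hθ : 0 < θ) :
    ∀ᶠ β : ℝ in atTop, 2 * (2 * (N : ℝ) * β) * Real.exp (-(β ^ (6 * θ))) ≤ β ^ (-θ) / 4 := by
  refine eventually_le_rpow_div_of_le_rpow_mul_exp (C := 4 * (N : ℝ)) (s := 1) (a := 6 * θ) (b₀ := 1) (-θ)
    (by positivity) one_pos (by norm_num) (fun β hβ => le_of_eq ?_)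
  rw [one_mul, Real.rpow_one]; ring

/-- **M2**: `M(e^{2w}−1) ≤ β^{−θ}/4` eventually. -/
theorem eventually_meanD_T2 (hθ : 0 < θ) (hθ2 : θ ≤ 1 / 200) (hCa : 0 ≤ Ca) (hC₂ : 0 ≤ C₂) :
    ∀ᶠ β : ℝ in atTop, β ^ (2 * (6 * θ)) * (Real.exp (2 * (120 * (2 * (⌈β ^ θ⌉₊ : ℝ) + 1) ^ 4 * (190 * β * (2 * ((12 * (⌈β ^ θ⌉₊ : ℝ) ^ 2 + 2 * ⌈β ^ θ⌉₊ + 1) * (Real.sqrt 2 * Real.sqrt (β ^ (2 * (6 * θ) - 1)) + 8 * (Ca * β ^ (3 * θ + θ / 5 - 1 / 2))))) ^ 3) + 4 * (2 * (⌈β ^ θ⌉₊ : ℝ) + 1) ^ 4 * (2 * C₂ * (2 * ((12 * (⌈β ^ θ⌉₊ : ℝ) ^ 2 + 2 * ⌈β ^ θ⌉₊ + 1) * (Real.sqrt 2 * Real.sqrt (β ^ (2 * (6 * θ) - 1)) + 8 * (Ca * β ^ (3 * θ + θ / 5 - 1 / 2))))) ^ 2))) - 1) ≤ β ^ (-θ)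 / 4 := by
  filter_upwards [eventually_tiltD_le_half hθ hθ2 hCa hC₂,
    eventually_le_rpow_div_of_le_rpow (f := fun β => 4 * (120 * 625 * 190 * (106 * (Real.sqrt 2 + 8 * Ca)) ^ 3) * β ^ (40 * θ - 1 / 2)) (b := -θ) (s := 40 * θ - 1 / 2)
      (by linarith) (by norm_num : (0 : ℝ) < 8) (fun β _ => le_rfl),
    eventually_le_rpow_div_of_le_rpow (f := fun β => 4 * (4 * 625 * (2 * C₂) * (106 * (Real.sqrt 2 + 8 * Ca)) ^ 2) * β ^ (32 * θ - 1)) (b := -θ) (s := 32 * θ - 1)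
      (by linarith) (by norm_num : (0 : ℝ) < 8) (fun β _ => le_rfl),
    eventually_ge_atTop (1 : ℝ)] with β hw h1 h2 hβ
  have hβ0 : 0 < β := by linarith
  have hr0 : 0 ≤ Ca * β ^ (3 * θ + θ / 5 - 1 / 2) := mul_nonneg hCa (Real.rpow_nonneg hβ0.le _)
  have hw0 : 0 ≤ (120 * (2 * (⌈β ^ θ⌉₊ : ℝ) + 1) ^ 4 * (190 * β * (2 * ((12 * (⌈β ^ θ⌉₊ : ℝ) ^ 2 + 2 * ⌈β ^ θ⌉₊ + 1) * (Real.sqrt 2 * Real.sqrt (β ^ (2 * (6 * θ) - 1)) + 8 * (Ca * β ^ (3 * θ + θ / 5 - 1 / 2))))) ^ 3) + 4 * (2 * (⌈β ^ θ⌉₊ : ℝ) + 1) ^ 4 * (2 * C₂ * (2 * ((12 * (⌈β ^ θ⌉₊ : ℝ) ^ 2 + 2 * ⌈β ^ θ⌉₊ + 1) * (Real.sqrt 2 * Real.sqrt (β ^ (2 * (6 * θ) - 1)) + 8 * (Ca * β ^ (3 * θ + θ / 5 - 1 / 2))))) ^ 2)) := by positivity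
  have hexp := exp_two_mul_sub_one_le_four_mul hw0 hw
  have hW := tiltD_majorant hβ hθ.le hCa hC₂
  rw [rpow_two_mul_six]
  have e1 : β ^ (12 * θ) * β ^ (28 * θ - 1 / 2) = β ^ (40 * θ - 1 / 2) := by rw [← Real.rpow_add hβ0]; ring_nf
  have e2 : β ^ (12 * θ) * β ^ (20 * θ - 1) = β ^ (32 * θ - 1) := by rw [← Real.rpow_add hβ0]; ring_nf
  have hM0 : 0 ≤ β ^ (12 * θ) := by positivity
  calc β ^ (12 * θ) * (Real.exp (2 * (120 * (2 * (⌈β ^ θ⌉₊ : ℝ) + 1) ^ 4 * (190 * β * (2 * ((12 * (⌈β ^ θ⌉₊ : ℝ) ^ 2 + 2 * ⌈β ^ θ⌉₊ + 1) * (Real.sqrt 2 * Real.sqrt (β ^ (2 * (6 * θ) - 1)) + 8 * (Ca * β ^ (3 * θ + θ / 5 - 1 / 2))))) ^ 3) + 4 * (2 * (⌈β ^ θ⌉₊ : ℝ) + 1) ^ 4 * (2 * C₂ * (2 * ((12 * (⌈β ^ θ⌉₊ : ℝ) ^ 2 + 2 * ⌈β ^ θ⌉₊ + 1) * (Real.sqrt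 2 * Real.sqrt (β ^ (2 * (6 * θ) - 1)) + 8 * (Ca * β ^ (3 * θ + θ / 5 - 1 / 2))))) ^ 2))) - 1) ≤ β ^ (12 * θ) * (4 * (120 * (2 * (⌈β ^ θ⌉₊ : ℝ) + 1) ^ 4 * (190 * β * (2 * ((12 * (⌈β ^ θ⌉₊ : ℝ) ^ 2 + 2 * ⌈β ^ θ⌉₊ + 1) * (Real.sqrt 2 * Real.sqrt (β ^ (2 * (6 * θ) - 1)) + 8 * (Ca * β ^ (3 * θ + θ / 5 - 1 / 2))))) ^ 3) + 4 * (2 * (⌈β ^ θ⌉₊ : ℝ) + 1) ^ 4 * (2 * C₂ * (2 * ((12 * (⌈β ^ θ⌉₊ : ℝ) ^ 2 + 2 * ⌈β ^ θ⌉₊ + 1) * (Real.sqrt 2 * Real.sqrt (β ^ (2 * (6 * θ) - 1)) + 8 * (Ca * β ^ (3 * θ + θ / 5 - 1 / 2))))) ^ 2))) := mul_le_mul_of_nonneg_left hexp hM0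
    _ ≤ β ^ (12 * θ) * (4 * ((120 * 625 * 190 * (106 * (Real.sqrt 2 + 8 * Ca)) ^ 3) * β ^ (28 * θ - 1 / 2) + (4 * 625 * (2 * C₂) * (106 * (Real.sqrt 2 + 8 * Ca)) ^ 2) * β ^ (20 * θ - 1))) := by gcongr
    _ = 4 * (120 * 625 * 190 * (106 * (Real.sqrt 2 + 8 * Ca)) ^ 3) * (β ^ (12 * θ) * β ^ (28 * θ - 1 / 2)) + 4 * (4 * 625 * (2 * C₂) * (106 * (Real.sqrt 2 + 8 * Ca)) ^ 2) * (β ^ (12 * θ) * β ^ (20 * θ - 1)) := by ring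
    _ = 4 * (120 * 625 * 190 * (106 * (Real.sqrt 2 + 8 * Ca)) ^ 3) * β ^ (40 * θ - 1 / 2) + 4 * (4 * 625 * (2 * C₂) * (106 * (Real.sqrt 2 + 8 * Ca)) ^ 2) * β ^ (32 * θ - 1) := by rw [e1, e2]
    _ ≤ β ^ (-θ) / 4 := by linarith

/-- **M3**: `τ ≤ β^{−θ}/4` eventually. -/
theorem eventually_meanD_T3 (hθ : 0 < θ) (hθ2 : θ ≤ 1 / 200) (hCa : 0 ≤ Ca) :
    ∀ᶠ β : ℝ in atTop, (190 * β * (2 * ((12 * (⌈β ^ θ⌉₊ : ℝ) ^ 2 + 2 * ⌈β ^ θ⌉₊ + 1) * (Real.sqrt 2 * Real.sqrt (β ^ (2 * (6 * θ) - 1)) + 8 * (Ca * β ^ (3 * θ + θ / 5 - 1 / 2))))) ^ 3) ≤ β ^ (-θ) / 4 :=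
  eventually_le_rpow_div_of_le_rpow (C := 190 * (106 * (Real.sqrt 2 + 8 * Ca)) ^ 3) (s := 24 * θ - 1 / 2) (b := -θ) (by linarith) (by norm_num)
    (fun β hβ => cubicD_majorant hβ hθ.le hCa)

/-- **M4**: `2(1+2D²(R'⁴+3))√P ≤ β^{−θ}/4` eventually. -/
theorem eventually_meanD_T4 (D : ℕ) (hθ : 0 < θ) (hCa : 0 ≤ Ca) :
    ∀ᶠ β : ℝ in atTop, 2 * (1 + 2 * (D : ℝ) ^ 2 * ((Real.sqrt (β * (CE * (2 * (⌈β ^ θ⌉₊ : ℝ) + 3) ^ 4 * β ^ (2 * (θ / 5) - 1))) + 4 * (Real.sqrt β * (Ca * β ^ (3 * θ + θ / 5 - 1 / 2)))) ^ 4 + 3)) * Real.sqrt (240 * (D : ℝ) * (2 * (⌈β ^ θ⌉₊ : ℝ) + 1) ^ 4 * Real.exp (-(β ^ (6 * θ) / (4 * (Real.sqrt D + 1))) ^ 2 / 2)) ≤ β ^ (-θ) / 4 := by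
  have hb₀ : (0 : ℝ) < (1 / (64 * (Real.sqrt D + 1) ^ 2)) := by positivity
  refine eventually_le_rpow_div_of_le_rpow_mul_exp (C := (2 * (1 + 2 * (D : ℝ) ^ 2 * ((49 * Real.sqrt CE + 4 * Ca) ^ 4 + 3))) * Real.sqrt (150000 * (D : ℝ)))
    (s := 4 * (3 * θ + θ / 5) + 2 * θ) (a := 12 * θ) (b₀ := (1 / (64 * (Real.sqrt D + 1) ^ 2))) (-θ) (by positivity) hb₀ (by norm_num) (fun β hβ => ?_)
  have hβ0 : 0 < β := by linarith
  obtain ⟨-, hsP⟩ := badMassD_majorant D hβ hθ.le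
  obtain ⟨-, -, -, hK4⟩ := momentsD_majorant (CE := CE) D hβ hθ.le hCa
  have hR'0 := backgroundD_nonneg hβ0.le hCa θ CE
  have h0 : 0 ≤ 2 * (1 + 2 * (D : ℝ) ^ 2 * ((Real.sqrt (β * (CE * (2 * (⌈β ^ θ⌉₊ : ℝ) + 3) ^ 4 * β ^ (2 * (θ / 5) - 1))) + 4 * (Real.sqrt β * (Ca * β ^ (3 * θ + θ / 5 - 1 / 2)))) ^ 4 + 3)) := by positivity
  have e : β ^ (4 * (3 * θ + θ / 5)) * β ^ (2 * θ) = β ^ (4 * (3 * θ + θ / 5) + 2 * θ) := by rw [← Real.rpow_add hβ0]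
  calc 2 * (1 + 2 * (D : ℝ) ^ 2 * ((Real.sqrt (β * (CE * (2 * (⌈β ^ θ⌉₊ : ℝ) + 3) ^ 4 * β ^ (2 * (θ / 5) - 1))) + 4 * (Real.sqrt β * (Ca * β ^ (3 * θ + θ / 5 - 1 / 2)))) ^ 4 + 3)) * Real.sqrt (240 * (D : ℝ) * (2 * (⌈β ^ θ⌉₊ : ℝ) + 1) ^ 4 * Real.exp (-(β ^ (6 * θ) / (4 * (Real.sqrt D + 1))) ^ 2 / 2))
      ≤ ((2 * (1 + 2 * (D : ℝ) ^ 2 * ((49 * Real.sqrt CE + 4 * Ca) ^ 4 + 3))) * β ^ (4 * (3 * θ + θ / 5))) * (Real.sqrt (150000 * (D : ℝ)) * β ^ (2 * θ) * Real.exp (-((1 / (64 * (Real.sqrt D + 1) ^ 2)) * β ^ (12 * θ)))) :=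
        mul_le_mul hK4 hsP (Real.sqrt_nonneg _) (by positivity)
    _ = (2 * (1 + 2 * (D : ℝ) ^ 2 * ((49 * Real.sqrt CE + 4 * Ca) ^ 4 + 3))) * Real.sqrt (150000 * (D : ℝ)) * (β ^ (4 * (3 * θ + θ / 5)) * β ^ (2 * θ)) * Real.exp (-((1 / (64 * (Real.sqrt D + 1) ^ 2)) * β ^ (12 * θ))) := by ring
    _ = _ := by rw [e]

/-! ## The window with the chart-ball radius `m` (w2's `…GaussTailDatumG` uses `190·m³`) -/

/-- The first window term: `(D/2)(R+R')²/β ≤ β^{12θ−1}/8` once `R' ≤ R` (from `cR·β^{3θ+θ/5} ≤ β^{6θ}/(4(√D+1))`). -/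
theorem firstTermD_le (D : ℕ) {β : ℝ} (hβ : 1 ≤ β) (hθ : 0 ≤ θ) (hCa : 0 ≤ Ca)
    (haux2 : (49 * Real.sqrt CE + 4 * Ca) * β ^ (3 * θ + θ / 5) ≤ β ^ (6 * θ) / (4 * (Real.sqrt D + 1))) :
    (D : ℝ) / 2 * ((β ^ (6 * θ) / (4 * (Real.sqrt D + 1))) + (Real.sqrt (β * (CE * (2 * (⌈β ^ θ⌉₊ : ℝ) + 3) ^ 4 * β ^ (2 * (θ / 5) - 1))) + 4 * (Real.sqrt β * (Ca * β ^ (3 * θ + θ / 5 - 1 / 2))))) ^ 2 / β ≤ β ^ (12 * θ - 1) / 8 := by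
  have hβ0 : 0 < β := by linarith
  have hR'0 := backgroundD_nonneg hβ0.le hCa θ CE
  have hR' : (Real.sqrt (β * (CE * (2 * (⌈β ^ θ⌉₊ : ℝ) + 3) ^ 4 * β ^ (2 * (θ / 5) - 1))) + 4 * (Real.sqrt β * (Ca * β ^ (3 * θ + θ / 5 - 1 / 2)))) ≤ (β ^ (6 * θ) / (4 * (Real.sqrt D + 1))) := (backgroundD_le hβ hθ hCa).trans haux2
  have hD1 : (0 : ℝ) < Real.sqrt D + 1 := by positivity
  have hDle : (D : ℝ) ≤ (Real.sqrt D + 1) ^ 2 := by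
    have h := Real.sq_sqrt (Nat.cast_nonneg D : (0 : ℝ) ≤ D)
    nlinarith [Real.sqrt_nonneg (D : ℝ)]
  have hsum : ((β ^ (6 * θ) / (4 * (Real.sqrt D + 1))) + (Real.sqrt (β * (CE * (2 * (⌈β ^ θ⌉₊ : ℝ) + 3) ^ 4 * β ^ (2 * (θ / 5) - 1))) + 4 * (Real.sqrt β * (Ca * β ^ (3 * θ + θ / 5 - 1 / 2))))) ^ 2 ≤ (2 * (β ^ (6 * θ) / (4 * (Real.sqrt D + 1)))) ^ 2 := pow_le_pow_left₀ (by positivity) (by linarith) 2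
  have hRsq : (2 * (β ^ (6 * θ) / (4 * (Real.sqrt D + 1)))) ^ 2 = β ^ (12 * θ) / (4 * (Real.sqrt D + 1) ^ 2) := by
    rw [mul_pow, div_pow, ← Real.rpow_natCast (β ^ (6 * θ)) 2, ← Real.rpow_mul hβ0.le,
      show 6 * θ * ((2 : ℕ) : ℝ) = 12 * θ by push_cast; ring]
    field_simp
    ring
  have h12 : β ^ (12 * θ) / β = β ^ (12 * θ - 1) := by rw [Real.rpow_sub_one hβ0.ne']
  have hD0 : (0 : ℝ) ≤ (D : ℝ) / 2 := by positivity
  calc (D : ℝ) / 2 * ((β ^ (6 * θ) / (4 * (Real.sqrt D + 1))) + (Real.sqrt (β * (CE * (2 * (⌈β ^ θ⌉₊ : ℝ) + 3) ^ 4 * β ^ (2 * (θ / 5) - 1))) + 4 * (Real.sqrt β * (Ca * β ^ (3 * θ + θ / 5 - 1 / 2))))) ^ 2 / β ≤ (D : ℝ) / 2 * (2 * (β ^ (6 * θ) / (4 * (Real.sqrt D + 1)))) ^ 2 / β := by gcongr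
    _ = (D : ℝ) / (8 * (Real.sqrt D + 1) ^ 2) * (β ^ (12 * θ) / β) := by rw [hRsq]; field_simp; ring
    _ ≤ 1 / 8 * (β ^ (12 * θ) / β) := by
        refine mul_le_mul_of_nonneg_right ?_ (by positivity)
        rw [div_le_iff₀ (by positivity)]; linarith
    _ = β ^ (12 * θ - 1) / 8 := by rw [h12]; ring

/-- **The window with the chart-ball radius**: `(D/2)(R+R')²/β + 190m³ < β^{2(6θ)−1}` from two monomial smallness conditions at `β ≥ 1`. -/
theorem windowD_m_of (D : ℕ) {β : ℝ} (hβ : 1 ≤ β) (hθ : 0 ≤ θ) (hCa : 0 ≤ Ca)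
    (haux2 : (49 * Real.sqrt CE + 4 * Ca) * β ^ (3 * θ + θ / 5) ≤ β ^ (6 * θ) / (4 * (Real.sqrt D + 1)))
    (haux4 : 190 * (106 * (Real.sqrt 2 + 8 * Ca)) ^ 3 * β ^ (24 * θ - 3 / 2) ≤ β ^ (12 * θ - 1) / 2) :
    (D : ℝ) / 2 * ((β ^ (6 * θ) / (4 * (Real.sqrt D + 1))) + (Real.sqrt (β * (CE * (2 * (⌈β ^ θ⌉₊ : ℝ) + 3) ^ 4 * β ^ (2 * (θ / 5) - 1))) + 4 * (Real.sqrt β * (Ca * β ^ (3 * θ + θ / 5 - 1 / 2))))) ^ 2 / β + 190 * (2 * ((12 * (⌈β ^ θ⌉₊ : ℝ) ^ 2 + 2 * ⌈β ^ θ⌉₊ + 1) * (Real.sqrt 2 * Real.sqrt (β ^ (2 * (6 * θ) - 1)) + 8 * (Ca * β ^ (3 * θ + θ / 5 - 1 / 2))))) ^ 3 < β ^ (2 * (6 * θ) - 1) := by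
  have hβ0 : 0 < β := by linarith
  have hfirst := firstTermD_le (CE := CE) D hβ hθ hCa haux2
  have hm0 := linkRadiusD_nonneg β θ Ca hCa hβ0.le
  have hm := linkRadiusD_le hβ hθ hCa
  have hcube : (2 * ((12 * (⌈β ^ θ⌉₊ : ℝ) ^ 2 + 2 * ⌈β ^ θ⌉₊ + 1) * (Real.sqrt 2 * Real.sqrt (β ^ (2 * (6 * θ) - 1)) + 8 * (Ca * β ^ (3 * θ + θ / 5 - 1 / 2))))) ^ 3 ≤ ((106 * (Real.sqrt 2 + 8 * Ca)) * β ^ (8 * θ - 1 / 2)) ^ 3 := pow_le_pow_left₀ hm0 hm 3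
  have hcube' : ((106 * (Real.sqrt 2 + 8 * Ca)) * β ^ (8 * θ - 1 / 2)) ^ 3 = (106 * (Real.sqrt 2 + 8 * Ca)) ^ 3 * β ^ (24 * θ - 3 / 2) := by
    rw [mul_pow, ← Real.rpow_natCast (β ^ (8 * θ - 1 / 2)) 3, ← Real.rpow_mul hβ0.le]; congr 2; push_cast; ring
  have hsecond : 190 * (2 * ((12 * (⌈β ^ θ⌉₊ : ℝ) ^ 2 + 2 * ⌈β ^ θ⌉₊ + 1) * (Real.sqrt 2 * Real.sqrt (β ^ (2 * (6 * θ) - 1)) + 8 * (Ca * β ^ (3 * θ + θ / 5 - 1 / 2))))) ^ 3 ≤ β ^ (12 * θ - 1) / 2 := by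
    calc 190 * (2 * ((12 * (⌈β ^ θ⌉₊ : ℝ) ^ 2 + 2 * ⌈β ^ θ⌉₊ + 1) * (Real.sqrt 2 * Real.sqrt (β ^ (2 * (6 * θ) - 1)) + 8 * (Ca * β ^ (3 * θ + θ / 5 - 1 / 2))))) ^ 3 ≤ 190 * ((106 * (Real.sqrt 2 + 8 * Ca)) ^ 3 * β ^ (24 * θ - 3 / 2)) := by rw [← hcube']; gcongr
      _ = 190 * (106 * (Real.sqrt 2 + 8 * Ca)) ^ 3 * β ^ (24 * θ - 3 / 2) := by ring
      _ ≤ β ^ (12 * θ - 1) / 2 := haux4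
  have hpos : 0 < β ^ (12 * θ - 1) := Real.rpow_pos_of_pos hβ0 _
  have e : β ^ (12 * θ - 1) = β ^ (2 * (6 * θ) - 1) := by congr 1; ring
  calc _ ≤ β ^ (12 * θ - 1) / 8 + β ^ (12 * θ - 1) / 2 := add_le_add hfirst hsecond
    _ < β ^ (12 * θ - 1) := by linarith
    _ = β ^ (2 * (6 * θ) - 1) := e

/-- The extra smallness condition for the `m³`-window, eventually (`θ ≤ 1/200`). -/
theorem eventually_windowD_aux4 (hθ2 : θ ≤ 1 / 200) :
    ∀ᶠ β : ℝ in atTop, 190 * (106 * (Real.sqrt 2 + 8 * Ca)) ^ 3 * β ^ (24 * θ - 3 / 2) ≤ β ^ (12 * θ - 1) / 2 :=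
  eventually_le_rpow_div_of_le_rpow (f := fun β => 190 * (106 * (Real.sqrt 2 + 8 * Ca)) ^ 3 * β ^ (24 * θ - 3 / 2)) (b := 12 * θ - 1)
    (by linarith) (by norm_num : (0 : ℝ) < 2) (fun β _ => le_rfl)

/-! ## The deliverable (lead p2's statement, crux dir `Lines/KernelDatumBoundsG_stmt.lean`, verbatim) -/

/-- **`eventually_kernelDatum_boundsG`** (PLAN v6, package p1; the lead's statement VERBATIM).  See the module docstring: the windows of the
one-scale expansion with datum and the two error sums of the cores with datum hold eventually in `β`, for `0 < θ ≤ 1/200` and all constants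
(the lead spells the scaled background `R' = √β·√B + 4√β·r`; `√β·√B = √(β·B)` bridges to parts 1–2). -/
theorem eventually_kernelDatum_boundsG (N D : ℕ) {Ca CE r₂ C₂ η₀ θ : ℝ} (hCa : 0 < Ca) (hCE : 0 < CE) (hr₂ : 0 < r₂) (hC₂ : 0 < C₂)
    (hη₀ : 0 < η₀) (hθ : 0 < θ) (hθ2 : θ ≤ 1 / 200) :
    ∀ᶠ β : ℝ in atTop, 1 ≤ β ∧ 8 * ⌈β ^ (θ / 20)⌉₊ ≤ ⌈β ^ θ⌉₊ ∧
      -- (1) link window below the local-surjectivity radius; chart ball radius m = 2L ≤ 1/4 and ≤ r₂ (Jacobian ball)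
      ((12 * (⌈β ^ θ⌉₊ : ℝ) ^ 2 + 2 * (⌈β ^ θ⌉₊ : ℝ) + 1) * (Real.sqrt 2 * Real.sqrt (β ^ (2 * (6 * θ) - 1)) + 8 * (Ca * β ^ (3 * θ + θ / 5 - 1 / 2)))) ≤ η₀ ∧
      (2 * ((12 * (⌈β ^ θ⌉₊ : ℝ) ^ 2 + 2 * (⌈β ^ θ⌉₊ : ℝ) + 1) * (Real.sqrt 2 * Real.sqrt (β ^ (2 * (6 * θ) - 1)) + 8 * (Ca * β ^ (3 * θ + θ / 5 - 1 / 2))))) ≤ 1 / 4 ∧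
      (2 * ((12 * (⌈β ^ θ⌉₊ : ℝ) ^ 2 + 2 * (⌈β ^ θ⌉₊ : ℝ) + 1) * (Real.sqrt 2 * Real.sqrt (β ^ (2 * (6 * θ) - 1)) + 8 * (Ca * β ^ (3 * θ + θ / 5 - 1 / 2))))) ≤ r₂ ∧
      -- (2) Gaussian link radius mE ≤ m and the goodTDE sandwich window
      (Real.sqrt D * ((12 * (⌈β ^ θ⌉₊ : ℝ) ^ 2 + 2 * (⌈β ^ θ⌉₊ : ℝ) + 1) * (((β ^ (6 * θ) / (4 * (Real.sqrt D + 1))) + (Real.sqrt β * Real.sqrt (CE * (2 * (⌈β ^ θ⌉₊ : ℝ) + 3) ^ 4 * β ^ (2 * (θ / 5) - 1)) + 4 * (Real.sqrt β * (Ca * β ^ (3 * θ + θ / 5 - 1 / 2))))) + 4 * (Real.sqrt β * (Ca * β ^ (3 * θ + θ / 5 - 1 / 2))))) / Real.sqrt β) ≤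
        (2 * ((12 * (⌈β ^ θ⌉₊ : ℝ) ^ 2 + 2 * (⌈β ^ θ⌉₊ : ℝ) + 1) * (Real.sqrt 2 * Real.sqrt (β ^ (2 * (6 * θ) - 1)) + 8 * (Ca * β ^ (3 * θ + θ / 5 - 1 / 2))))) ∧
      (D : ℝ) / 2 * ((β ^ (6 * θ) / (4 * (Real.sqrt D + 1))) + (Real.sqrt β * Real.sqrt (CE * (2 * (⌈β ^ θ⌉₊ : ℝ) + 3) ^ 4 * β ^ (2 * (θ / 5) - 1)) + 4 * (Real.sqrt β * (Ca * β ^ (3 * θ + θ / 5 - 1 / 2))))) ^ 2 / β + 190 * (2 * ((12 * (⌈β ^ θ⌉₊ : ℝ) ^ 2 + 2 * (⌈β ^ θ⌉₊ : ℝ) + 1) * (Real.sqrt 2 * Real.sqrt (β ^ (2 * (6 * θ) - 1)) + 8 * (Ca * β ^ (3 * θ + θ / 5 - 1 / 2))))) ^ 3 < β ^ (2 * (6 * θ) - 1) ∧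
      -- (3) Gaussian bad mass P ≤ 1/2
      (240 * (D : ℝ) * (2 * (⌈β ^ θ⌉₊ : ℝ) + 1) ^ 4 * Real.exp (-(β ^ (6 * θ) / (4 * (Real.sqrt D + 1))) ^ 2 / 2)) ≤ 1 / 2 ∧
      -- (4) the covariance core's bound is ≤ β^(-θ/2)
      6 * (2 * N * β) * (2 * N * β) * Real.exp (-(β ^ (6 * θ))) +
        (3 * (β ^ (2 * (6 * θ))) ^ 2 * (Real.exp (2 * (120 * (2 * (⌈β ^ θ⌉₊ : ℝ) + 1) ^ 4 * (190 * β * (2 * ((12 * (⌈β ^ θ⌉₊ : ℝ) ^ 2 + 2 * (⌈β ^ θ⌉₊ : ℝ) + 1) * (Real.sqrt 2 * Real.sqrt (β ^ (2 * (6 * θ) - 1)) + 8 * (Ca * β ^ (3 * θ + θ / 5 - 1 / 2))))) ^ 3) + 4 * (2 * (⌈β ^ θ⌉₊ : ℝ) + 1) ^ 4 * (2 * C₂ * (2 * ((12 * (⌈β ^ θ⌉₊ : ℝ) ^ 2 + 2 * (⌈β ^ θ⌉₊ : ℝ) + 1) * (Real.sqrt 2 * Real.sqrt (β ^ (2 *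 (6 * θ) - 1)) + 8 * (Ca * β ^ (3 * θ + θ / 5 - 1 / 2))))) ^ 2))) - 1) +
          6 * (β ^ (2 * (6 * θ))) ^ 2 * (240 * (D : ℝ) * (2 * (⌈β ^ θ⌉₊ : ℝ) + 1) ^ 4 * Real.exp (-(β ^ (6 * θ) / (4 * (Real.sqrt D + 1))) ^ 2 / 2)) +
          2 * (190 * β * (2 * ((12 * (⌈β ^ θ⌉₊ : ℝ) ^ 2 + 2 * (⌈β ^ θ⌉₊ : ℝ) + 1) * (Real.sqrt 2 * Real.sqrt (β ^ (2 * (6 * θ) - 1)) + 8 * (Ca * β ^ (3 * θ + θ / 5 - 1 / 2))))) ^ 3) * (β ^ (2 * (6 * θ)) + (2 * (D : ℝ) * ((Real.sqrt β * Real.sqrt (CE * (2 * (⌈β ^ θ⌉₊ : ℝ) + 3) ^ 4 * β ^ (2 * (θ / 5) - 1)) + 4 * (Real.sqrt β * (Ca * β ^ (3 * θ + θ / 5 - 1 / 2)))) ^ 2 + 2))) +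
          Real.sqrt (240 * (D : ℝ) * (2 * (⌈β ^ θ⌉₊ : ℝ) + 1) ^ 4 * Real.exp (-(β ^ (6 * θ) / (4 * (Real.sqrt D + 1))) ^ 2 / 2)) * (2 * β ^ (2 * (6 * θ)) * (2 * (D : ℝ) * ((Real.sqrt β * Real.sqrt (CE * (2 * (⌈β ^ θ⌉₊ : ℝ) + 3) ^ 4 * β ^ (2 * (θ / 5) - 1)) + 4 * (Real.sqrt β * (Ca * β ^ (3 * θ + θ / 5 - 1 / 2)))) ^ 2 + 2)) + (3 * (D : ℝ) ^ 2 * ((Real.sqrt β * Real.sqrt (CE * (2 * (⌈β ^ θ⌉₊ : ℝ) + 3) ^ 4 * β ^ (2 * (θ / 5) - 1)) + 4 * (Real.sqrt β * (Ca * β ^ (3 * θ + θ / 5 - 1 / 2)))) ^ 4 + 11)) + (2 * (D : ℝ) * ((Real.sqrt β * Real.sqrt (CE * (2 * (⌈β ^ θ⌉₊ : ℝ) + 3) ^ 4 * β ^ (2 * (θ / 5) - 1)) + 4 * (Real.sqrt β * (Ca * β ^ (3 * θ + θ / 5 - 1 / 2)))) ^ 2 + 2)) ^ 2)) ≤ β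 ^ (-(θ / 2)) ∧
      -- (5) the mean core's bound is ≤ β^(-θ)
      2 * (2 * N * β) * Real.exp (-(β ^ (6 * θ))) +
        (β ^ (2 * (6 * θ)) * (Real.exp (2 * (120 * (2 * (⌈β ^ θ⌉₊ : ℝ) + 1) ^ 4 * (190 * β * (2 * ((12 * (⌈β ^ θ⌉₊ : ℝ) ^ 2 + 2 * (⌈β ^ θ⌉₊ : ℝ) + 1) * (Real.sqrt 2 * Real.sqrt (β ^ (2 * (6 * θ) - 1)) + 8 * (Ca * β ^ (3 * θ + θ / 5 - 1 / 2))))) ^ 3) + 4 * (2 * (⌈β ^ θ⌉₊ : ℝ) + 1) ^ 4 * (2 * C₂ * (2 * ((12 * (⌈β ^ θ⌉₊ : ℝ) ^ 2 + 2 * (⌈β ^ θ⌉₊ : ℝ) + 1) * (Real.sqrt 2 * Real.sqrt (β ^ (2 * (6 * θ) - 1)) + 8 * (Ca * β ^ (3 * θ + θ / 5 - 1 / 2))))) ^ 2))) - 1) + (190 * β * (2 * ((12 * (⌈β ^ θ⌉₊ : ℝ) ^ 2 + 2 * (⌈β ^ θ⌉₊ : ℝ) + 1) * (Real.sqrt 2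 * Real.sqrt (β ^ (2 * (6 * θ) - 1)) + 8 * (Ca * β ^ (3 * θ + θ / 5 - 1 / 2))))) ^ 3) +
          2 * (1 + 2 * (D : ℝ) ^ 2 * ((Real.sqrt β * Real.sqrt (CE * (2 * (⌈β ^ θ⌉₊ : ℝ) + 3) ^ 4 * β ^ (2 * (θ / 5) - 1)) + 4 * (Real.sqrt β * (Ca * β ^ (3 * θ + θ / 5 - 1 / 2)))) ^ 4 + 3)) * Real.sqrt (240 * (D : ℝ) * (2 * (⌈β ^ θ⌉₊ : ℝ) + 1) ^ 4 * Real.exp (-(β ^ (6 * θ) / (4 * (Real.sqrt D + 1))) ^ 2 / 2))) ≤ β ^ (-θ) := by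
  have _hCE : 0 < CE := hCE
  have _hC₂ : 0 < C₂ := hC₂
  filter_upwards [eventually_ge_atTop (1 : ℝ), eventually_eight_ceil_le hθ, eventually_halfLinkD_le hθ hθ2 hCa.le hη₀,
    eventually_linkD_le hθ hθ2 hCa.le (by norm_num : (0 : ℝ) < 1 / 4), eventually_linkD_le hθ hθ2 hCa.le hr₂,
    eventually_windowD_aux (Ca := Ca) (CE := CE) D hθ hθ2, eventually_windowD_aux4 (Ca := Ca) hθ2, eventually_badMassD_le_half D hθ,
    eventually_covD_T1 N hθ, eventually_covD_T2 hθ hθ2 hCa.le hC₂.le, eventually_covD_T3 D hθ,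
    eventually_covD_T4 (CE := CE) D hθ hθ2 hCa.le, eventually_covD_T5 (CE := CE) D hθ hCa.le,
    eventually_meanD_T1 N hθ, eventually_meanD_T2 hθ hθ2 hCa.le hC₂.le, eventually_meanD_T3 hθ hθ2 hCa.le,
    eventually_meanD_T4 (CE := CE) D hθ hCa.le]
    with β hβ h8 hL hm4 hmr haux haux4 hP hc1 hc2 hc3 hc4 hc5 hm1 hm2 hm3 hmm4
  have hβ0 : 0 < β := by linarith
  obtain ⟨haux1, haux2, -⟩ := haux
  obtain ⟨hmEm, -, -⟩ := mED_majorant (CE := CE) D hβ hθ.le hCa.le haux1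
  have hwin := windowD_m_of (CE := CE) D hβ hθ.le hCa.le haux2 haux4
  -- the lead's spelling of the scaled background: `√β·√B = √(β·B)`
  have hRp : Real.sqrt β * Real.sqrt (CE * (2 * (⌈β ^ θ⌉₊ : ℝ) + 3) ^ 4 * β ^ (2 * (θ / 5) - 1)) = Real.sqrt (β * (CE * (2 * (⌈β ^ θ⌉₊ : ℝ) + 3) ^ 4 * β ^ (2 * (θ / 5) - 1))) := (Real.sqrt_mul hβ0.le _).symm
  rw [hRp]
  refine ⟨hβ, h8, hL, hm4, hmr, hmEm, hwin, hP, by linarith, by linarith⟩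

end Summit.QuantumFields.YangMills.Theorems.ColdBoxAllGroups

end
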